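import Mathlib
import Literature.Probability.RandomPlanarGeometry.HexSAW

/-!
# Exact two-gate factorisation of the critical SAW weight (`GateDecomposition`)

Stub `stub_gateDecomposition` of the line `bridge-gate-renewal` for the crux
`Summit.CriticalPhenomena.SAWScalingLimit.Theses.SAWDefectDecoherence.ObservableToSLER`
(item stmt-CriticalPhenomena-14005): the lever of the line, at the level of the un-normalised
critical weights `hexSAWWeight = Σ_γ x_c^{ℓ(γ)} δ_γ`.

In a discrete domain `Ω_δ` fix a self-avoiding prefix `w₁ : a → p` with support `l₁ ⊆ S`, a
self-avoiding suffix `w₂ : p' → b` with support `l₂ ⊆ T`, `S ∩ T = ∅`, and two edges `p ∼ q`,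
`q' ∼ p'` of `Ω_δ`.  Concatenation `γ' ↦ w₁ · (p,q) · γ' · (q',p') · w₂` is a bijection from the
SAWs `γ' : q → q'` of `Ω_δ` avoiding `S ∪ T` whose support lies in an arbitrary set `B` of vertex
lists onto the SAWs `γ : a → b` whose support is `l₁ ++ mid ++ l₂` for such a middle list
`mid ∈ B`; it multiplies the weight `x^{ℓ}` (`ℓ` = number of vertices) by the constant
`x^{|l₁| + |l₂|}`.  Summing gives the identity of measures `stub_gateDecomposition` — Kesten's
bridge decomposition / the restriction property of the self-avoiding walk as a weight-preserving
bijection (Kesten 1963 §4; Madras–Slade 1993 §4.2; Lawler–Schramm–Werner 2004 §3.4).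

Contents: walk surgery in a simple graph (`support_append_cons_append_cons`, the support of the
glued walk `w₁ · (p,q) · w · (q',p') · w₂`; `exists_append_cons_of_support_eq_append`: a walk whose
support is `l₁ ++ l₂` splits accordingly; `nodup_append_append_of_separated`); SAWs
(`embDomainSAW_eq_of_walk_eq`, `vertexCount_eq_length_support`); the weight of a set of SAWs as a
`tsum` (`embWeight_apply_eq_tsum`) and its transport along a weight-shifting bijection
(`embWeight_eq_mul_of_equiv`); the factorisation for a general embedded graph and fugacity
`x ≥ 0` (`embWeight_gate_factorisation`, where the gluing bijection is built); the registered
hexagonal statement (`stub_gateDecomposition`).  No finiteness of the SAW spaces is used: all sums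
are `ℝ≥0∞`-valued `tsum`s, so `Ω` and `δ` are arbitrary.  The file introduces no definitions.
-/

noncomputable section

open scoped BigOperators Topology NNReal ENNReal Classical BoundedContinuousFunction
open Filter Set MeasureTheory Metric
open Literature.Probability.LatticeModels (HexVertex hexGraph hexCenter triZeta Site)
open Literature.Probability.RandomPlanarGeometry
open Literature.Probability.RandomPlanarGeometry.SAW

namespace Summit.CriticalPhenomena.SAWScalingLimit.Theorems.ObservableToSLER.BridgeGate

/-! ### Walk surgery in a simple graph -/

section Walks

variable {V : Type*} {G : SimpleGraph V}

/-- The support of a walk `u → v` starts with `u`. [folklore] -/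
theorem support_head?_eq {u v : V} (w : G.Walk u v) : w.support.head? = some u := by
  cases w <;> rfl

/-- The support of a walk `u → v` ends with `v`. [folklore] -/
theorem support_getLast?_eq {u v : V} (w : G.Walk u v) : w.support.getLast? = some v := by
  rw [List.getLast?_eq_some_getLast w.support_ne_nil, SimpleGraph.Walk.getLast_support]

/-- The support of the glued walk `w₁ · (p,q) · w · (q',p') · w₂` (prefix `w₁ : a → p`, edge
`p ∼ q`, middle piece `w : q → q'`, edge `q' ∼ p'`, suffix `w₂ : p' → b`) is the concatenation of
the three supports. [folklore] -/
theorem support_append_cons_append_cons {a p q q' p' b : V} (w₁ : G.Walk a p) (hpq : G.Adj p q)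
    (w : G.Walk q q') (hq'p' : G.Adj q' p') (w₂ : G.Walk p' b) :
    (w₁.append (SimpleGraph.Walk.cons hpq (w.append (SimpleGraph.Walk.cons hq'p' w₂)))).support =
      w₁.support ++ w.support ++ w₂.support := by
  simp [SimpleGraph.Walk.support_append, List.append_assoc]

/-- A walk whose support is a concatenation `l₁ ++ l₂` of two nonempty lists splits as
`w₁ · (x, y) · w₂` with `w₁.support = l₁` and `w₂.support = l₂`. [folklore] -/
theorem exists_append_cons_of_support_eq_append {u v : V} (w : G.Walk u v) :
    ∀ (l₁ l₂ : List V), l₁ ≠ [] → l₂ ≠ [] → w.support = l₁ ++ l₂ →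
      ∃ (x y : V) (hxy : G.Adj x y) (w₁ : G.Walk u x) (w₂ : G.Walk y v),
        w = w₁.append (SimpleGraph.Walk.cons hxy w₂) ∧ w₁.support = l₁ ∧ w₂.support = l₂ := by
  induction w with
  | nil =>
    intro l₁ l₂ h₁ h₂ h
    obtain ⟨z, l₁', rfl⟩ := List.exists_cons_of_ne_nil h₁
    obtain ⟨z', l₂', rfl⟩ := List.exists_cons_of_ne_nil h₂
    have hlen := congrArg List.length h
    simp only [SimpleGraph.Walk.support_nil, List.length_cons, List.length_nil,
      List.length_append] at hlen
    omega
  | cons hux w' ih =>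
    intro l₁ l₂ h₁ h₂ h
    obtain ⟨z, l₁', rfl⟩ := List.exists_cons_of_ne_nil h₁
    rw [SimpleGraph.Walk.support_cons, List.cons_append, List.cons.injEq] at h
    obtain ⟨rfl, h'⟩ := h
    rcases eq_or_ne l₁' [] with rfl | hl
    · exact ⟨_, _, hux, SimpleGraph.Walk.nil, w', by simp, by simp, by simpa using h'⟩
    · obtain ⟨x', y, hxy, w₁', w₂, hw, hs₁, hs₂⟩ := ih l₁' l₂ hl h₂ h'
      exact ⟨x', y, hxy, SimpleGraph.Walk.cons hux w₁', w₂,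
        by rw [hw, SimpleGraph.Walk.cons_append], by rw [SimpleGraph.Walk.support_cons, hs₁], hs₂⟩

/-- Three concatenated duplicate-free lists lying in `S`, outside `S ∪ T`, in `T` respectively,
with `S ∩ T = ∅`, form a duplicate-free list. [folklore] -/
theorem nodup_append_append_of_separated {S T : Set V} (hST : Disjoint S T) {l₁ m l₂ : List V}
    (h₁ : l₁.Nodup) (hm : m.Nodup) (h₂ : l₂.Nodup) (hS : ∀ v ∈ l₁, v ∈ S) (hT : ∀ v ∈ l₂, v ∈ T)
    (hmid : ∀ v ∈ m, v ∉ S ∧ v ∉ T) : (l₁ ++ m ++ l₂).Nodup := by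
  refine (h₁.append hm fun v hv₁ hvm => (hmid v hvm).1 (hS v hv₁)).append h₂ fun v hv hv₂ => ?_
  rcases List.mem_append.1 hv with hv₁ | hvm
  · exact Set.disjoint_left.1 hST (hS v hv₁) (hT v hv₂)
  · exact (hmid v hvm).2 (hT v hv₂)

end Walks

/-! ### Self-avoiding walks of a discrete domain: gluing and weights -/

section SAW

variable {V : Type*} {G : SimpleGraph V} {emb : V → ℂ} {Ω : Set ℂ} {δ : ℝ}

/-- A SAW of `Ω_δ` is determined by its underlying walk. [folklore] -/
theorem embDomainSAW_eq_of_walk_eq {a b : V} {γ₁ γ₂ : EmbDomainSAW G emb Ω δ a b}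
    (h : γ₁.walk = γ₂.walk) : γ₁ = γ₂ := by
  cases γ₁
  cases γ₂
  cases h
  rfl

/-- `ℓ(γ)` (the number of vertices) is the length of the support. [folklore] -/
theorem vertexCount_eq_length_support {a b : V} (γ : EmbDomainSAW G emb Ω δ a b) :
    γ.vertexCount = γ.walk.support.length := by
  rw [SimpleGraph.Walk.length_support]
  rfl

/-- The weight of a set `A` of SAWs is `Σ_{γ ∈ A} x^{ℓ(γ)}` (an `ℝ≥0∞`-valued `tsum`; no
finiteness needed). [folklore] -/
theorem embWeight_apply_eq_tsum (x : ℝ) {a b : V} (A : Set (EmbDomainSAW G emb Ω δ a b)) :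
    embWeight G emb Ω δ x a b A =
      ∑' γ : A, ENNReal.ofReal (x ^ (γ : EmbDomainSAW G emb Ω δ a b).vertexCount) := by
  rw [embWeight, Measure.sum_apply _ MeasurableSpace.measurableSet_top,
    tsum_subtype A fun γ => ENNReal.ofReal (x ^ γ.vertexCount)]
  refine tsum_congr fun γ => ?_
  rw [Measure.smul_apply, smul_eq_mul, Measure.dirac_apply' _ MeasurableSpace.measurableSet_top]
  by_cases hγ : γ ∈ A
  · rw [Set.indicator_of_mem hγ, Set.indicator_of_mem hγ, Pi.one_apply, mul_one]
  · rw [Set.indicator_of_notMem hγ, Set.indicator_of_notMem hγ, mul_zero]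

/-- Transport of the weight along a bijection of SAW sets shifting `ℓ` by a constant `n`:
the weight gets multiplied by `x ^ n`. [folklore] -/
theorem embWeight_eq_mul_of_equiv {x : ℝ} (hx : 0 ≤ x) {a b a' b' : V}
    (A : Set (EmbDomainSAW G emb Ω δ a b)) (A' : Set (EmbDomainSAW G emb Ω δ a' b')) (n : ℕ)
    (e : A' ≃ A)
    (he : ∀ γ' : A', (e γ' : EmbDomainSAW G emb Ω δ a b).vertexCount =
      n + (γ' : EmbDomainSAW G emb Ω δ a' b').vertexCount) :
    embWeight G emb Ω δ x a b A = ENNReal.ofReal (x ^ n) * embWeight G emb Ω δ x a' b' A' := by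
  rw [embWeight_apply_eq_tsum, embWeight_apply_eq_tsum, ← ENNReal.tsum_mul_left, ← e.tsum_eq]
  refine tsum_congr fun γ' => ?_
  rw [he, pow_add, ENNReal.ofReal_mul (pow_nonneg hx n)]

/-- **Exact two-gate factorisation** for the SAW weight at fugacity `x ≥ 0` of an arbitrary
embedded graph: with a fixed self-avoiding prefix (support `l₁ ⊆ S`) and suffix (support
`l₂ ⊆ T`), `S ∩ T = ∅`, and junction edges `p ∼ q`, `q' ∼ p'`, the weight of the walks `a → b` with
support `l₁ ++ mid ++ l₂`, `mid ∈ B` running from `q` to `q'` outside `S ∪ T`, is `x^{|l₁|+|l₂|}`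
times the weight of the SAWs `q → q'` outside `S ∪ T` with support in `B` (concatenation is a
weight-preserving bijection). Kesten 1963 §4; Madras–Slade 1993 §4.2. [folklore] -/
theorem embWeight_gate_factorisation {x : ℝ} (hx : 0 ≤ x) (a b p q p' q' : V) (S T : Set V)
    (l₁ l₂ : List V) (B : Set (List V)) (hST : Disjoint S T)
    (h₁ : ∃ w₁ : (embDomainGraph G emb Ω δ).Walk a p,
      w₁.IsPath ∧ w₁.support = l₁ ∧ ∀ v ∈ l₁, v ∈ S)
    (h₂ : ∃ w₂ : (embDomainGraph G emb Ω δ).Walk p' b,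
      w₂.IsPath ∧ w₂.support = l₂ ∧ ∀ v ∈ l₂, v ∈ T)
    (hpq : (embDomainGraph G emb Ω δ).Adj p q) (hq'p' : (embDomainGraph G emb Ω δ).Adj q' p') :
    embWeight G emb Ω δ x a b
        {γ | ∃ mid ∈ B, mid.head? = some q ∧ mid.getLast? = some q' ∧
          (∀ v ∈ mid, v ∉ S ∧ v ∉ T) ∧ γ.walk.support = l₁ ++ mid ++ l₂} =
      ENNReal.ofReal (x ^ (l₁.length + l₂.length)) *
        embWeight G emb Ω δ x q q'
          {γ | γ.walk.support ∈ B ∧ ∀ v ∈ γ.walk.support, v ∉ S ∧ v ∉ T} := by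
  obtain ⟨w₁, hw₁, rfl, hS⟩ := h₁
  obtain ⟨w₂, hw₂, rfl, hT⟩ := h₂
  set A : Set (EmbDomainSAW G emb Ω δ a b) :=
    {γ | ∃ mid ∈ B, mid.head? = some q ∧ mid.getLast? = some q' ∧
      (∀ v ∈ mid, v ∉ S ∧ v ∉ T) ∧ γ.walk.support = w₁.support ++ mid ++ w₂.support} with hA
  set A' : Set (EmbDomainSAW G emb Ω δ q q') :=
    {γ | γ.walk.support ∈ B ∧ ∀ v ∈ γ.walk.support, v ∉ S ∧ v ∉ T} with hA'
  -- the forward (gluing) map `A' → A`: `γ' ↦ w₁ · (p,q) · γ' · (q',p') · w₂`, self-avoiding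
  -- because the prefix lies in `S`, the suffix in `T`, the middle avoids `S ∪ T`, `S ∩ T = ∅`
  have hpath : ∀ γ' : A', (w₁.append (SimpleGraph.Walk.cons hpq
      (γ'.1.walk.append (SimpleGraph.Walk.cons hq'p' w₂)))).IsPath := fun γ' =>
    SimpleGraph.Walk.IsPath.mk' (by
      rw [support_append_cons_append_cons]
      exact nodup_append_append_of_separated hST hw₁.support_nodup γ'.1.isPath.support_nodup
        hw₂.support_nodup hS hT γ'.2.2)
  have hmem : ∀ γ' : A', (⟨_, hpath γ'⟩ : EmbDomainSAW G emb Ω δ a b) ∈ A := fun γ' =>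
    ⟨γ'.1.walk.support, γ'.2.1, support_head?_eq _, support_getLast?_eq _, γ'.2.2,
      support_append_cons_append_cons _ _ _ _ _⟩
  let Φ : A' → A := fun γ' => ⟨⟨_, hpath γ'⟩, hmem γ'⟩
  have hΦwalk : ∀ γ' : A', ((Φ γ' : A) : EmbDomainSAW G emb Ω δ a b).walk =
      w₁.append (SimpleGraph.Walk.cons hpq (γ'.1.walk.append (SimpleGraph.Walk.cons hq'p' w₂))) :=
    fun _ => rfl
  -- injective: the support of the glued walk determines the middle support
  have hΦinj : Function.Injective Φ := by
    intro γ₁ γ₂ h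
    have h' := congrArg (fun γ : A => (γ : EmbDomainSAW G emb Ω δ a b).walk.support) h
    simp only [hΦwalk, support_append_cons_append_cons] at h'
    exact Subtype.ext (embDomainSAW_eq_of_walk_eq (SimpleGraph.Walk.ext_support
      (List.append_cancel_left (List.append_cancel_right h'))))
  -- surjective: cut the middle piece out of a walk with support `l₁ ++ mid ++ l₂`
  have hΦsurj : Function.Surjective Φ := by
    rintro ⟨γ, mid, hB, hhead, hlast, havoid, hsupp⟩
    have hmid : mid ≠ [] := by
      rintro rfl
      simp at hhead
    obtain ⟨x₁, y₁, hxy₁, u₁, u₂, -, -, hu₂⟩ :=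
      exists_append_cons_of_support_eq_append γ.walk w₁.support (mid ++ w₂.support)
        w₁.support_ne_nil (by simp [hmid]) (by rw [hsupp, List.append_assoc])
    obtain ⟨x₂, y₂, hxy₂, um, u₃, -, hum, -⟩ :=
      exists_append_cons_of_support_eq_append u₂ mid w₂.support hmid w₂.support_ne_nil hu₂
    have hy : y₁ = q := by
      have h := support_head?_eq um
      rw [hum, hhead] at h
      exact (Option.some_injective _ h).symm
    have hx : x₂ = q' := by
      have h := support_getLast?_eq um
      rw [hum, hlast] at h
      exact (Option.some_injective _ h).symm
    have hnd : mid.Nodup := by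
      have h := γ.isPath.support_nodup
      rw [hsupp] at h
      exact h.of_append_left.of_append_right
    let γ' : EmbDomainSAW G emb Ω δ q q' :=
      ⟨um.copy hy hx, SimpleGraph.Walk.IsPath.mk' (by rwa [SimpleGraph.Walk.support_copy, hum])⟩
    have hγ' : γ'.walk.support = mid := by
      show (um.copy hy hx).support = mid
      rw [SimpleGraph.Walk.support_copy, hum]
    have hγ'A : γ' ∈ A' := by
      rw [hA', Set.mem_setOf_eq, hγ']
      exact ⟨hB, havoid⟩
    refine ⟨⟨γ', hγ'A⟩, Subtype.ext (embDomainSAW_eq_of_walk_eq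
      (SimpleGraph.Walk.ext_support ?_))⟩
    rw [hΦwalk, support_append_cons_append_cons, hsupp, hγ']
  -- lengths add
  have he : ∀ γ' : A', ((Equiv.ofBijective Φ ⟨hΦinj, hΦsurj⟩ γ' : A) :
      EmbDomainSAW G emb Ω δ a b).vertexCount =
        (w₁.support.length + w₂.support.length) +
          (γ' : EmbDomainSAW G emb Ω δ q q').vertexCount := by
    intro γ'
    rw [Equiv.ofBijective_apply, vertexCount_eq_length_support, vertexCount_eq_length_support,
      hΦwalk, support_append_cons_append_cons, List.length_append, List.length_append]
    omega
  exact embWeight_eq_mul_of_equiv hx A A' _ (Equiv.ofBijective Φ ⟨hΦinj, hΦsurj⟩) he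

end SAW

/-! ### The registered statement (hexagonal lattice, critical fugacity) -/

/-- STUB 1 of the line `bridge-gate-renewal` — **`GateDecomposition`, the exact two-gate
factorisation of the critical hexagonal SAW weight** (definitionally the typed statement
`Cruxes.ObservableToSLER.BridgeGateRenewal.GateDecomposition` of the skeleton).  In any domain
`Ω_δ ⊆ δℍ`, for disjoint vertex sets `S ⊇ l₁` (`l₁` the support of a SAW `a → p`) and `T ⊇ l₂`
(`l₂` the support of a SAW `p' → b`) and edges `p ∼ q`, `q' ∼ p'` of `Ω_δ`: the `x_c`-weight of
the walks `a → b` whose support is `l₁ ++ mid ++ l₂` with `mid ∈ B` running from `q` to `q'`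
outside `S ∪ T` equals `x_c^{|l₁|+|l₂|}` times the `x_c`-weight of the SAWs `q → q'` of `Ω_δ`
outside `S ∪ T` with support in `B`.  The instance `G = hexGraph`, `emb = hexCenter`, `x = x_c`
of `embWeight_gate_factorisation` (`x_c > 0`, `hexCriticalFugacity_pos_lt_one`).  Kesten 1963 §4;
Madras–Slade 1993 §4.2; Lawler–Schramm–Werner 2004 §3.4 (restriction property). [folklore] -/
theorem stub_gateDecomposition :
    ∀ (Ω : Set ℂ) (δ : ℝ) (a b p q p' q' : HexVertex) (S T : Set HexVertex) (l₁ l₂ : List HexVertex)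
      (B : Set (List HexVertex)),
      Disjoint S T →
      (∃ w₁ : (hexDomainGraph Ω δ).Walk a p, w₁.IsPath ∧ w₁.support = l₁ ∧ ∀ v ∈ l₁, v ∈ S) →
      (∃ w₂ : (hexDomainGraph Ω δ).Walk p' b, w₂.IsPath ∧ w₂.support = l₂ ∧ ∀ v ∈ l₂, v ∈ T) →
      (hexDomainGraph Ω δ).Adj p q → (hexDomainGraph Ω δ).Adj q' p' →
      hexSAWWeight Ω δ a b
          {γ | ∃ mid ∈ B, mid.head? = some q ∧ mid.getLast? = some q' ∧
            (∀ v ∈ mid, v ∉ S ∧ v ∉ T) ∧ γ.walk.support = l₁ ++ mid ++ l₂} =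
        ENNReal.ofReal (hexCriticalFugacity ^ (l₁.length + l₂.length)) *
          hexSAWWeight Ω δ q q'
            {γ | γ.walk.support ∈ B ∧ ∀ v ∈ γ.walk.support, v ∉ S ∧ v ∉ T} := by
  intro Ω δ a b p q p' q' S T l₁ l₂ B hST h₁ h₂ hpq hq'p'
  exact embWeight_gate_factorisation hexCriticalFugacity_pos_lt_one.1.le a b p q p' q' S T l₁ l₂ B
    hST h₁ h₂ hpq hq'p'

end Summit.CriticalPhenomena.SAWScalingLimit.Theorems.ObservableToSLER.BridgeGate
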